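import Summits.ValiantsHypothesis.ValiantsHypothesis.Theorems.FifoMatchingNNDivisionHardExactPencilTogetherFace
import HarnessLib

/-!
# EXACT PENCILS IX — ★★★ W7-K1: every SPARSE-GENERATOR cube is pinned at a together face, hence DECIDED by C′ (budget-free) (crux `NNDivisionHard`, stmt-ValiantsHypothesis-21181) — `ExactPencil` port part 9/12

Theorems-side port (staged by val-idea-40 g6, C′-census owner per director-valiant R331 (2)(e) / desk #399, for the port hands;
press as `Theorems/FifoMatchingNNDivisionHardExactPencilSparsePins.lean`, `--kind proof --supports stmt-ValiantsHypothesis-21181 --as helper`; sig-first val-idea-crit-9 g3) of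
§12 of val-idea-38 g2's crux workfile `Cruxes/NNDivisionHard/ExactPencil38.lean` REV 16 @4e81d1716f6b (sha16 d9f2e288279a0b09, 3 456 l., FROZEN — final from 38 g2, bus 01:14:51Z; critic of record val-idea-crit-9 g2/g3: `CRITIC-wave6.md` FINAL + V#97 §2 «rev 14/15 δ KERNEL VERIFIED»).  Declaration texts VERBATIM (namespace
`…Theorems.FifoMatching.ExactPencil`; one-line docstrings added where the source had none); the 40-g5 tools the source RESTATED are
DROPPED here and cited BY NAME from the landed ports `…Theorems.FifoMatching.LocatedRows.*` (✓ p680125 … p683387: `T`, `RowFamily`,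
`hCOR`, `exactTilted`, `ExactPencilLaw`, `pinnedRows`, `unflat`, `three_pow_le_of_block`, `two_pow_half_mul_le`, `zgen`, `cubePt`, …) and
`…Theorems.FifoMatching.XcDivision` (`udRow`, `udPt`, `udInd`, `udMat`, …), so that C′ stays ONE Theorems declaration
`LocatedRows.ExactPencilLaw`.  Part 9/12 of the port (imports part 8, `…Theorems.FifoMatchingNNDivisionHardExactPencilTogetherFace`).

* `LocatedRows.flat_add'`, `abs_udRow_dotProduct_flat_le` / `abs_flat_dotProduct_udPt_le` (here from the landed `LocatedRows` `l1` bounds), `faceZero` (+ `_zero/_add/_smul`),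
  `Ed` (row move `E_{xy} − E_{xy'}`), `flat_Ed_dotProduct_flat`, `Ed_faceZero`, ★ `exists_witness_of_sparse`, ★ `exists_faceZero_reads_ne`, `Wtog_term_nonpos`,
  ★ `Wtog_dotProduct_udPt_le_neg_one` (off-face margin), `eq_bUn_image`, ★★ `exists_pins_of_sparse`, ★★★ `cor_add_sparseCube_bound`
  (`3^k ≤ (r+1)·2^k` for every cube whose generators have `< min block size` nonzero columns), `sparseCube_block`.

HONEST LABEL: every theorem here is a DECIDED SPECIES / support lemma for the OPEN law C′ = `LocatedRows.ExactPencilLaw`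
(`exactTilted.Law`); the crux 21181 `NNDivisionHard`, C′, `allRows.Law` and COR-VIRTUAL are OPEN; C⁺_entry `LocatedPencilLaw` is
REFUTED (✓ p679540).  VP ≠ VNP is NOT proved here or anywhere in this tree.
-/

set_option autoImplicit false

-- the mandated summit-side namespace repeats a component by design (single-problem summit)
set_option linter.dupNamespace false

noncomputable section

open Matrix Finset
open scoped Pointwise

namespace Summit.ValiantsHypothesis.ValiantsHypothesis.Theorems.FifoMatching.ExactPencil

open Literature.Barriers.PneNP (HasEFOfSize three_pow_le_card_mul_two_pow_of_cover_univ)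
open Literature.Combinatorics.Optimization.FixedSizePsdRank
  (corPolytope flat vecOuter flat_dotProduct_le_of_mem_corPolytope flat_dotProduct_vecOuter)
open Summit.ValiantsHypothesis.ValiantsHypothesis.Theorems.FifoMatching.XcDivision
  (udRow udPt udInd udMat ud_data udInd_apply udInd_sq dot_le_of_mem_convexHull flat_dotProduct_flat)
open Summit.ValiantsHypothesis.ValiantsHypothesis.Theorems.FifoMatching.LocatedRows
  (T CorVirtualHardN RowFamily corVirtualHardN_of_law flat_le_box entryTilted allRows LocatedPencilLaw
    hCOR le_hCOR exists_eq_hCOR flat_le_hCOR hCOR_le_box exactTilted ExactPencilLaw exactTilted_emb_allRows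
    corVirtualHardN_of_exactPencilLaw three_pow_le_of_block two_pow_half_mul_le pinnedRows unflat flat_unflat
    pinnedRows_emb_exactTilted corVirtualHardN_of_pinnedRowsLaw zgen cubePt dotProduct_cubePt)

/-! ## §12 W7-K1 IN KERNEL: every SPARSE-GENERATOR cube is pinned at a together face, hence decided by C′ (budget-free)

`exists_pins_of_sparse`: generators with nonzero entries in column sets `Vs t`, `|Vs t| < |A_i|` for every block ⇒ a direction tight on
`F_β` pinning the cube uniformly: explicit face-zero readers `Ed x y y' = E_{xy} − E_{xy'}` (`y ~ y'`; `exists_witness_of_sparse`, the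
NON-BLOCKY LEMMA), finite avoidance over the generators (`exists_reads_ne_of_closed`, `exists_faceZero_reads_ne`: `V ↦ L•V + U`, `L` above
every bad ratio), then `W = μ•W^β + λ•V` (`λ` beats the clique weights `Σ|g_t|`, `μ` beats the off-face reads, `Wtog_dotProduct_udPt_le_neg_one`).
With §11: ★★★ `cor_add_sparseCube_bound : 3^k ≤ (r+1)·2^k` for every EF of `COR(n) +` (sparse cube) — `Q_pair`, zgen/`Z_mix` cubes, `Q∘`,
`Q^Π` as a zonotope, coordinate cubes and `Q_II` in one theorem. -/

section SparsePins

variable {n k : ℕ}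

/-- clique weights are bounded by the `ℓ¹` mass of the generator (= the landed `LocatedRows.abs_udRow_dotProduct_flat_le`,
whose right-hand side `l1 g` unfolds to this double sum). -/
theorem abs_udRow_dotProduct_flat_le (a : Finset (Fin n)) (g : Matrix (Fin n) (Fin n) ℝ) :
    |udRow a ⬝ᵥ flat g| ≤ ∑ x, ∑ y, |g x y| :=
  LocatedRows.abs_udRow_dotProduct_flat_le a g

/-- located reads at vertices are bounded by the `ℓ¹` mass of the direction (= the landed
`LocatedRows.abs_flat_dotProduct_udPt_le`). -/
theorem abs_flat_dotProduct_udPt_le (V : Matrix (Fin n) (Fin n) ℝ) (b : Finset (Fin n)) :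
    |flat V ⬝ᵥ udPt b| ≤ ∑ x, ∑ y, |V x y| :=
  LocatedRows.abs_flat_dotProduct_udPt_le V b

/-! ### face-zero directions -/

/-- directions reading zero on the whole together face `F_β`. -/
def faceZero (β : Fin n → Fin k) (V : Matrix (Fin n) (Fin n) ℝ) : Prop := ∀ S : Finset (Fin k), flat V ⬝ᵥ udPt (bUn β S) = 0

/-- `0` is face-zero. -/
theorem faceZero_zero (β : Fin n → Fin k) : faceZero β 0 := fun S => by
  rw [ShadowConstRead.flat_zero₄₁, zero_dotProduct]

/-- face-zero directions are closed under addition. -/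
theorem faceZero_add {β : Fin n → Fin k} {V V' : Matrix (Fin n) (Fin n) ℝ} (h : faceZero β V) (h' : faceZero β V') :
    faceZero β (V + V') := fun S => by
  rw [LocatedRows.flat_add', add_dotProduct, h S, h' S, add_zero]

/-- face-zero directions are closed under scalars. -/
theorem faceZero_smul {β : Fin n → Fin k} {V : Matrix (Fin n) (Fin n) ℝ} (c : ℝ) (h : faceZero β V) :
    faceZero β (c • V) := fun S => by
  rw [LocatedRows.flat_smul', smul_dotProduct, h S, smul_zero]

/-- the explicit face-zero direction `E_{xy} − E_{xy'}`. -/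
def Ed (x y y' : Fin n) : Matrix (Fin n) (Fin n) ℝ := fun p q =>
  if p = x then (if q = y then (1 : ℝ) else 0) - (if q = y' then (1 : ℝ) else 0) else 0

/-- the row move `E_{xy} − E_{xy'}` reads `g x y − g x y'`. -/
theorem flat_Ed_dotProduct_flat (x y y' : Fin n) (g : Matrix (Fin n) (Fin n) ℝ) :
    flat (Ed x y y') ⬝ᵥ flat g = g x y - g x y' := by
  classical
  rw [flat_dotProduct_flat]
  have h : ∀ p, ∑ q, Ed x y y' p q * g p q = if p = x then g x y - g x y' else 0 := by
    intro p
    unfold Ed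
    by_cases hp : p = x
    · subst hp
      simp only [if_true, sub_mul, Finset.sum_sub_distrib, ite_mul, one_mul, zero_mul, Finset.sum_ite_eq',
        Finset.mem_univ]
    · simp [hp]
  rw [Finset.sum_congr rfl fun p _ => h p, Finset.sum_ite_eq' Finset.univ x, if_pos (Finset.mem_univ x)]

/-- a row move inside one block (`β y = β y'`) is face-zero. -/
theorem Ed_faceZero (β : Fin n → Fin k) {x y y' : Fin n} (hyy' : β y = β y') : faceZero β (Ed x y y') := by
  classical
  intro S
  rw [flat_dotProduct_udPt_sum]
  refine Finset.sum_eq_zero fun p _ => ?_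
  unfold Ed
  by_cases hp : p = x
  · subst hp
    simp only [if_true]
    rw [Finset.sum_sub_distrib, Finset.sum_ite_eq' (bUn β S) y, Finset.sum_ite_eq' (bUn β S) y']
    have : (y ∈ bUn β S) ↔ (y' ∈ bUn β S) := by rw [mem_bUn, mem_bUn, hyy']
    by_cases hy : y ∈ bUn β S
    · rw [if_pos hy, if_pos (this.mp hy), sub_self]
    · rw [if_neg hy, if_neg (fun h => hy (this.mpr h)), sub_self]
  · simp [hp]

/-- ★ the NON-BLOCKY LEMMA as a witness: a nonzero generator whose nonzero columns lie in a set smaller than every block is read by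
some explicit face-zero direction. -/
theorem exists_witness_of_sparse (β : Fin n → Fin k) {N : ℕ} (G : Fin N → Matrix (Fin n) (Fin n) ℝ)
    (Vs : Fin N → Finset (Fin n)) (hG : ∀ t x y, G t x y ≠ 0 → y ∈ Vs t) (hs : ∀ t i, (Vs t).card < bsize β i)
    (t : Fin N) (ht : G t ≠ 0) : ∃ U, faceZero β U ∧ flat U ⬝ᵥ flat (G t) ≠ 0 := by
  classical
  obtain ⟨x, y, hxy⟩ : ∃ x y, G t x y ≠ 0 := by
    by_contra h
    push Not at h
    exact ht (Matrix.ext fun x y => by rw [h x y]; rfl)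
  obtain ⟨y', hy'A, hy'V⟩ : ∃ y' ∈ Finset.univ.filter (fun z => β z = β y), y' ∉ Vs t := by
    by_contra h
    push Not at h
    exact absurd (Finset.card_le_card (fun z hz => h z hz)) (not_le.mpr (hs t (β y)))
  have hβ : β y' = β y := (Finset.mem_filter.mp hy'A).2
  have h0 : G t x y' = 0 := by
    by_contra h
    exact hy'V (hG t x y' h)
  refine ⟨Ed x y y', Ed_faceZero β hβ.symm, ?_⟩
  rw [flat_Ed_dotProduct_flat, h0, sub_zero]
  exact hxy

/-- FINITE AVOIDANCE for any class of directions closed under `0, +, •` (generalises `exists_faceZero_reads_ne`). -/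
theorem exists_reads_ne_of_closed (P : Matrix (Fin n) (Fin n) ℝ → Prop) (h0 : P 0) (hadd : ∀ V V', P V → P V' → P (V + V'))
    (hsmul : ∀ (c : ℝ) V, P V → P (c • V)) {N : ℕ} (G : Fin N → Matrix (Fin n) (Fin n) ℝ)
    (hw : ∀ t, G t ≠ 0 → ∃ U, P U ∧ flat U ⬝ᵥ flat (G t) ≠ 0) :
    ∀ T : Finset (Fin N), ∃ V, P V ∧ ∀ t ∈ T, G t ≠ 0 → flat V ⬝ᵥ flat (G t) ≠ 0 := by
  classical
  intro T
  induction T using Finset.induction_on with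
  | empty => exact ⟨0, h0, fun t ht => absurd ht (Finset.notMem_empty t)⟩
  | insert m T hm ih =>
    obtain ⟨V, hV, hVT⟩ := ih
    by_cases hm0 : G m = 0
    · refine ⟨V, hV, fun t ht h0' => ?_⟩
      rcases Finset.mem_insert.mp ht with rfl | ht'
      · exact absurd hm0 h0'
      · exact hVT t ht' h0'
    · obtain ⟨U, hU, hUm⟩ := hw m hm0
      let rU : Fin N → ℝ := fun t => flat U ⬝ᵥ flat (G t)
      let rV : Fin N → ℝ := fun t => flat V ⬝ᵥ flat (G t)
      let f : Fin N → ℝ := fun t => -(rU t) / rV t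
      let L : ℝ := 1 + ∑ t ∈ insert m T, |f t|
      have hL : ∀ t ∈ insert m T, L ≠ f t := by
        intro t ht hLt
        have h1 : |f t| ≤ ∑ t ∈ insert m T, |f t| :=
          Finset.single_le_sum (f := fun t => |f t|) (fun t _ => abs_nonneg _) ht
        have h2 : f t ≤ |f t| := le_abs_self _
        have h3 : L = 1 + ∑ t ∈ insert m T, |f t| := rfl
        linarith
      have hkey : ∀ t ∈ insert m T, rV t ≠ 0 → L * rV t + rU t ≠ 0 := by
        intro t ht hrV heq
        apply hL t ht
        show L = -(rU t) / rV t
        rw [eq_div_iff hrV]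
        linarith
      refine ⟨L • V + U, hadd _ _ (hsmul L _ hV) hU, fun t ht h0' => ?_⟩
      rw [LocatedRows.flat_add', LocatedRows.flat_smul', add_dotProduct, smul_dotProduct, smul_eq_mul]
      show L * rV t + rU t ≠ 0
      rcases Finset.mem_insert.mp ht with rfl | ht'
      · by_cases hrV : rV t = 0
        · rw [hrV, mul_zero, zero_add]; exact hUm
        · exact hkey t ht hrV
      · exact hkey t ht (hVT t ht' h0')

/-- FINITE AVOIDANCE: one face-zero direction reading every (nonzero) generator of a finite set. -/
theorem exists_faceZero_reads_ne (β : Fin n → Fin k) {N : ℕ} (G : Fin N → Matrix (Fin n) (Fin n) ℝ)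
    (hw : ∀ t, G t ≠ 0 → ∃ U, faceZero β U ∧ flat U ⬝ᵥ flat (G t) ≠ 0) :
    ∀ T : Finset (Fin N), ∃ V, faceZero β V ∧ ∀ t ∈ T, G t ≠ 0 → flat V ⬝ᵥ flat (G t) ≠ 0 :=
  exists_reads_ne_of_closed (faceZero β) (faceZero_zero β) (fun _ _ h h' => faceZero_add h h')
    (fun c _ h => faceZero_smul c h) G hw

/-! ### the off-face margin of `W^β` -/

/-- each term `|b ∩ block(z)| − |block(z)|` is `≤ 0`. -/
theorem Wtog_term_nonpos (β : Fin n → Fin k) (b : Finset (Fin n)) (z : Fin n) :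
    ((b.filter (fun y => β y = β z)).card : ℝ) - (bsize β (β z) : ℝ) ≤ 0 := by
  classical
  have : (b.filter (fun y => β y = β z)).card ≤ bsize β (β z) :=
    Finset.card_le_card (fun y hy => by
      rw [Finset.mem_filter] at hy ⊢
      exact ⟨Finset.mem_univ y, hy.2⟩)
  have h' : ((b.filter (fun y => β y = β z)).card : ℝ) ≤ (bsize β (β z) : ℝ) := by exact_mod_cast this
  linarith

/-- off the together face `W^β` reads `≤ −1`: if `x ∈ b`, `y ∉ b` lie in one block. -/
theorem Wtog_dotProduct_udPt_le_neg_one (β : Fin n → Fin k) {b : Finset (Fin n)} {x y : Fin n}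
    (hx : x ∈ b) (hy : y ∉ b) (hβ : β x = β y) : flat (Wtog β) ⬝ᵥ udPt b ≤ -1 := by
  classical
  rw [Wtog_dotProduct_udPt, ← Finset.add_sum_erase b _ hx]
  have hrest : ∑ z ∈ b.erase x, (((b.filter (fun y => β y = β z)).card : ℝ) - (bsize β (β z) : ℝ)) ≤ 0 :=
    Finset.sum_nonpos fun z _ => Wtog_term_nonpos β b z
  have hlt : (b.filter (fun y => β y = β x)).card < bsize β (β x) := by
    refine Finset.card_lt_card (Finset.ssubset_iff_subset_ne.mpr ⟨?_, ?_⟩)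
    · intro z hz
      rw [Finset.mem_filter] at hz ⊢
      exact ⟨Finset.mem_univ z, hz.2⟩
    · intro h
      have : y ∈ b.filter (fun y => β y = β x) := by
        rw [h, Finset.mem_filter]; exact ⟨Finset.mem_univ y, hβ.symm⟩
      exact hy (Finset.mem_filter.mp this).1
  have hx' : ((b.filter (fun y => β y = β x)).card : ℝ) + 1 ≤ (bsize β (β x) : ℝ) := by
    exact_mod_cast Nat.lt_iff_add_one_le.mp hlt
  linarith

/-- a set closed under the block relation is a union of blocks. -/
theorem eq_bUn_image (β : Fin n → Fin k) {b : Finset (Fin n)} (hb : ∀ x y, β x = β y → x ∈ b → y ∈ b) :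
    b = bUn β (b.image β) := by
  classical
  ext z
  rw [mem_bUn, Finset.mem_image]
  constructor
  · exact fun hz => ⟨z, hz, rfl⟩
  · rintro ⟨x, hx, hxz⟩
    exact hb x z hxz hx

/-! ### ★★★ W7-K1 -/

/-- ★★★ **EVERY SPARSE-GENERATOR CUBE IS PINNED AT A TOGETHER FACE**: if the nonzero columns of every generator lie in a set smaller than
every block, some direction is tight on `F_β` (exact rhs `h_COR = 0`) and pins the cube uniformly. -/
theorem exists_pins_of_sparse (β : Fin n → Fin k) {N : ℕ} (G : Fin N → Matrix (Fin n) (Fin n) ℝ)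
    (Vs : Fin N → Finset (Fin n)) (hG : ∀ t x y, G t x y ≠ 0 → y ∈ Vs t) (hs : ∀ t i, (Vs t).card < bsize β i) :
    ∃ W : Matrix (Fin n) (Fin n) ℝ, (∀ S, flat W ⬝ᵥ udPt (bUn β S) = hCOR W) ∧ Pins W G := by
  classical
  obtain ⟨V, hV, hVr⟩ := exists_faceZero_reads_ne β G (exists_witness_of_sparse β G Vs hG hs) Finset.univ
  -- constants
  let C : Fin N → ℝ := fun t => ∑ x, ∑ y, |G t x y|
  have hC0 : ∀ t, 0 ≤ C t := fun t => Finset.sum_nonneg fun x _ => Finset.sum_nonneg fun y _ => abs_nonneg _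
  let rV : Fin N → ℝ := fun t => flat V ⬝ᵥ flat (G t)
  let lam : ℝ := 1 + ∑ t, (if rV t = 0 then 0 else (C t + 1) / |rV t|)
  have hlam_term : ∀ t, 0 ≤ (if rV t = 0 then 0 else (C t + 1) / |rV t|) := fun t => by
    split_ifs
    · exact le_refl _
    · exact div_nonneg (by linarith [hC0 t]) (abs_nonneg _)
  have hlam0 : 0 ≤ lam := by
    have := Finset.sum_nonneg fun t (_ : t ∈ Finset.univ) => hlam_term t
    show 0 ≤ 1 + _
    linarith
  have hlam_ge : ∀ t, rV t ≠ 0 → (C t + 1) / |rV t| ≤ lam := by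
    intro t ht
    have h1 := Finset.single_le_sum (f := fun t => if rV t = 0 then 0 else (C t + 1) / |rV t|)
      (fun t _ => hlam_term t) (Finset.mem_univ t)
    simp only [if_neg ht] at h1
    show _ ≤ 1 + _
    linarith
  let V₁ : Matrix (Fin n) (Fin n) ℝ := lam • V
  have hV₁ : faceZero β V₁ := faceZero_smul lam hV
  let v : Fin N → ℝ := fun t => flat V₁ ⬝ᵥ flat (G t)
  have hv : ∀ t, v t = lam * rV t := fun t => by
    show flat (lam • V) ⬝ᵥ flat (G t) = lam * (flat V ⬝ᵥ flat (G t))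
    rw [LocatedRows.flat_smul', smul_dotProduct, smul_eq_mul]
  -- every nonzero generator NOT read by `W^β` is read by `V₁` above its clique weights
  have hv_big : ∀ t, G t ≠ 0 → C t < |v t| := by
    intro t ht
    have hr : rV t ≠ 0 := hVr t (Finset.mem_univ t) ht
    have hrpos : 0 < |rV t| := abs_pos.mpr hr
    rw [hv t, abs_mul, abs_of_nonneg hlam0]
    have : (C t + 1) / |rV t| * |rV t| ≤ lam * |rV t| := mul_le_mul_of_nonneg_right (hlam_ge t hr) (abs_nonneg _)
    rw [div_mul_cancel₀ _ (ne_of_gt hrpos)] at this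
    linarith
  let B : ℝ := ∑ x, ∑ y, |V₁ x y|
  let w : Fin N → ℝ := fun t => flat (Wtog β) ⬝ᵥ flat (G t)
  let μ : ℝ := 1 + B + ∑ t, (if w t = 0 then 0 else (C t + |v t| + 1) / |w t|)
  have hμ_term : ∀ t, 0 ≤ (if w t = 0 then 0 else (C t + |v t| + 1) / |w t|) := fun t => by
    split_ifs
    · exact le_refl _
    · exact div_nonneg (by linarith [hC0 t, abs_nonneg (v t)]) (abs_nonneg _)
  have hB0 : 0 ≤ B := Finset.sum_nonneg fun x _ => Finset.sum_nonneg fun y _ => abs_nonneg _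
  have hμB : 1 + B ≤ μ := by
    have := Finset.sum_nonneg fun t (_ : t ∈ Finset.univ) => hμ_term t
    show 1 + B ≤ 1 + B + _
    linarith
  have hμ0 : 0 ≤ μ := by linarith
  have hμ_ge : ∀ t, w t ≠ 0 → (C t + |v t| + 1) / |w t| ≤ μ := by
    intro t ht
    have h1 := Finset.single_le_sum (f := fun t => if w t = 0 then 0 else (C t + |v t| + 1) / |w t|)
      (fun t _ => hμ_term t) (Finset.mem_univ t)
    simp only [if_neg ht] at h1
    show _ ≤ 1 + B + _
    linarith
  -- the direction
  let W : Matrix (Fin n) (Fin n) ℝ := μ • Wtog β + V₁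
  have hWread : ∀ b, flat W ⬝ᵥ udPt b = μ * (flat (Wtog β) ⬝ᵥ udPt b) + flat V₁ ⬝ᵥ udPt b := fun b => by
    show flat (μ • Wtog β + V₁) ⬝ᵥ udPt b = _
    rw [LocatedRows.flat_add', LocatedRows.flat_smul', add_dotProduct, smul_dotProduct, smul_eq_mul]
  have hWS : ∀ S, flat W ⬝ᵥ udPt (bUn β S) = 0 := fun S => by
    rw [hWread, Wtog_dotProduct_bUn, hV₁ S, mul_zero, add_zero]
  have hWle : ∀ b, flat W ⬝ᵥ udPt b ≤ 0 := by
    intro b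
    by_cases hb : ∀ x y, β x = β y → x ∈ b → y ∈ b
    · rw [eq_bUn_image β hb, hWS]
    · push Not at hb
      obtain ⟨x, y, hβ, hx, hy⟩ := hb
      rw [hWread]
      have h1 : flat (Wtog β) ⬝ᵥ udPt b ≤ -1 := Wtog_dotProduct_udPt_le_neg_one β hx hy hβ
      have h2 : flat V₁ ⬝ᵥ udPt b ≤ B := (le_abs_self _).trans (abs_flat_dotProduct_udPt_le V₁ b)
      have h3 : μ * (flat (Wtog β) ⬝ᵥ udPt b) ≤ μ * (-1) := mul_le_mul_of_nonneg_left h1 hμ0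
      linarith
  have hCOR_W : hCOR W = 0 :=
    le_antisymm (Finset.sup'_le _ _ fun b _ => hWle b) (by have h := le_hCOR W (bUn β ∅); rwa [hWS] at h)
  refine ⟨W, fun S => by rw [hWS, hCOR_W], fun t => ?_⟩
  -- pins
  by_cases h0 : G t = 0
  · left
    intro a
    rw [h0, ShadowConstRead.flat_zero₄₁, dotProduct_zero]
  have hscore : ∀ a, (udRow a + flat W) ⬝ᵥ flat (G t) = udRow a ⬝ᵥ flat (G t) + (μ * w t + v t) := fun a => by
    show (udRow a + flat (μ • Wtog β + V₁)) ⬝ᵥ flat (G t) = _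
    rw [add_dotProduct, LocatedRows.flat_add', LocatedRows.flat_smul', add_dotProduct, smul_dotProduct, smul_eq_mul]
  have hpin : C t < |μ * w t + v t| := by
    by_cases hw0 : w t = 0
    · rw [hw0, mul_zero, zero_add]; exact hv_big t h0
    · have hwpos : 0 < |w t| := abs_pos.mpr hw0
      have h1 : (C t + |v t| + 1) / |w t| * |w t| ≤ μ * |w t| := mul_le_mul_of_nonneg_right (hμ_ge t hw0) (abs_nonneg _)
      rw [div_mul_cancel₀ _ (ne_of_gt hwpos)] at h1
      have h2 : |μ * w t| = μ * |w t| := by rw [abs_mul, abs_of_nonneg hμ0]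
      have h3 : |μ * w t| ≤ |μ * w t + v t| + |v t| := by
        have := abs_sub (μ * w t + v t) (v t)
        rwa [add_sub_cancel_right] at this
      linarith
  have hcw : ∀ a, |udRow a ⬝ᵥ flat (G t)| ≤ C t := fun a => abs_udRow_dotProduct_flat_le a (G t)
  rcases lt_abs.mp hpin with hpos | hneg
  · left
    intro a
    rw [hscore a]
    have := (abs_le.mp (hcw a)).1
    linarith
  · right
    intro a
    rw [hscore a]
    have := (abs_le.mp (hcw a)).2
    linarith

/-- ★★★ **EVERY SPARSE-GENERATOR CUBE IS DECIDED** (top law, budget-free): `3^k ≤ (r+1)·2^k` for every EF of `COR(n) + cube` whenever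
the generators' nonzero columns lie in sets smaller than every block of a `k`-block assignment. -/
theorem cor_add_sparseCube_bound {β : Fin n → Fin k} {σ : Fin k → Fin n} (hβσ : ∀ i, β (σ i) = i)
    {N : ℕ} (Q₀ : Matrix (Fin n) (Fin n) ℝ) (G : Fin N → Matrix (Fin n) (Fin n) ℝ)
    (Vs : Fin N → Finset (Fin n)) (hG : ∀ t x y, G t x y ≠ 0 → y ∈ Vs t) (hs : ∀ t i, (Vs t).card < bsize β i) (r : ℕ)
    (hEF : HasEFOfSize (corPolytope n + convexHull ℝ (Set.range (cubePt Q₀ G))) r) :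
    3 ^ k ≤ (r + 1) * 2 ^ k := by
  obtain ⟨W, ht, hp⟩ := exists_pins_of_sparse β G Vs hG hs
  exact cor_add_cube_bound_of_pinning hβσ Q₀ G W ht hp r hEF

/-- the same in `ExactPencilLaw` / listed-passenger currency. -/
theorem sparseCube_block {β : Fin n → Fin k} {σ : Fin k → Fin n} (hβσ : ∀ i, β (σ i) = i)
    {N K : ℕ} (Q₀ : Matrix (Fin n) (Fin n) ℝ) (G : Fin N → Matrix (Fin n) (Fin n) ℝ)
    (Vs : Fin N → Finset (Fin n)) (hG : ∀ t x y, G t x y ≠ 0 → y ∈ Vs t) (hs : ∀ t i, (Vs t).card < bsize β i)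
    (e : Fin (K + 1) → Finset (Fin N)) (he : Function.Surjective e) (r : ℕ)
    (mm : exactTilted.A n → ℝ) (hle : ∀ a j, exactTilted.ρ n a ⬝ᵥ (cubePt Q₀ G ∘ e) j ≤ mm a)
    (hat : ∀ a, ∃ j, exactTilted.ρ n a ⬝ᵥ (cubePt Q₀ G ∘ e) j = mm a)
    (U : exactTilted.A n → Option (Fin r) → ℝ) (V : Finset (Fin n) × Fin (K + 1) → Option (Fin r) → ℝ)
    (hU : ∀ a i, 0 ≤ U a i) (hV : ∀ p i, 0 ≤ V p i)
    (hfac : ∀ a b j, (exactTilted.β n a + mm a) - exactTilted.ρ n a ⬝ᵥ (udPt b + (cubePt Q₀ G ∘ e) j) = ∑ i, U a i * V (b, j) i) :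
    3 ^ k ≤ (r + 1) * 2 ^ k := by
  obtain ⟨W, ht, hp⟩ := exists_pins_of_sparse β G Vs hG hs
  exact cube_block_of_pinning hβσ Q₀ G W ht hp e he r mm hle hat U V hU hV hfac

end SparsePins

end Summit.ValiantsHypothesis.ValiantsHypothesis.Theorems.FifoMatching.ExactPencil
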